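import Literature.Analysis.FluidPDE.GaussianVortexLinearLamGap
import Mathlib.MeasureTheory.Function.L2Space
import Mathlib.MeasureTheory.Function.LpSpace.Indicator
import Mathlib.Analysis.InnerProductSpace.ProdL2
import HarnessLib

/-!
# The Gaussian measure `μ_λ = ρ_λ dx` and the form domain of `L_λ` (weighted `H¹`)

Analysis/FluidPDE definitions file for the linear theory behind the named fact
`Literature.Analysis.FluidPDE.GallayMaekawa2016_thm41` (Gallay–Maekawa 2016, Thm. 4.1). In the
ground-state picture `w = ρ_λ u` (`GaussianVortexLinearLamGap`: `ρ_λ⁻¹ L_λ ρ_λ = Δ − b_λ·∇`,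
`ρ_λ = exp(−(1+λ)x₀²/4 − (1−λ)x₁²/4)`), the natural Hilbert spaces are `L²(μ_λ)`,
`μ_λ = ρ_λ dx`, and the weighted Sobolev space `H¹(μ_λ)` — the FORM DOMAIN of the Dirichlet form
`∫ ∇u·∇v dμ_λ` of `L_λ` (Gallay–Maekawa 2016, (4.6): `W^{1,2}(∞;λ)` on the vorticity side). We set
up, for the Lax–Milgram inversion of `L_λ` on mean-zero data (`GaussianVortexLinearLamSolver`):

* `gaussLamMeasure lam = μ_λ` (a `withDensity` measure): locally finite, finite for
  `λ ∈ [0,1)`, mutually absolutely continuous with Lebesgue measure, `∫ f dμ_λ = ∫ f ρ_λ`;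
* `planarTestFunctions` — `C_c^∞(ℝ²)` as a submodule of `ℝ² → ℝ`;
* `gaussLamGraph lam : C_c^∞ →ₗ L²(μ_λ) × L²(μ_λ; ℝ²)`, `φ ↦ (φ, ∇φ)` (the `L²`-product carries the
  Hilbert structure `WithLp 2`);
* `gaussLamFormDomain lam = H¹(μ_λ)` := the closure of the range of `gaussLamGraph` — a closed
  subspace, hence a Hilbert space; its elements are pairs `(u, G)` with `G` the weak `μ_λ`-gradient
  of `u` (`integral_fst_mul_weightedDiv_eq`, the defining integration-by-parts identity survives
  the closure).

Design: defining `H¹(μ_λ)` as a graph closure (rather than through distributional derivatives)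
makes completeness and the density of test functions definitional; the price is that membership
of a given function must be shown by approximation (constants: `GaussianVortexLinearLamSolver`).

## References

* Th. Gallay, Y. Maekawa, *Existence and stability of viscous vortices*, arXiv:1610.08384, §4.1,
  (4.4)–(4.6). [GallayMaekawa2016]
* D. Bakry, I. Gentil, M. Ledoux, *Analysis and Geometry of Markov Diffusion Operators*,
  §3.3.1 (Dirichlet forms and their domains). [folklore]
-/

open MeasureTheory Filter Set WithLp
open scoped Real RealInnerProductSpace Topology InnerProductSpace ContDiff

noncomputable section

namespace Literature.Analysis.FluidPDE

/-! ### The measure `μ_λ = ρ_λ dx` -/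

/-- The anisotropic Gaussian measure `μ_λ = ρ_λ(x) dx` on `ℝ²`,
`ρ_λ(x) = exp(−(1+λ)x₀²/4 − (1−λ)x₁²/4)` (the profile of Gallay–Maekawa's `𝒢_λ`, (4.4), without
its normalisation `√(1−λ²)/(4π)`). [cite: GallayMaekawa2016, (4.4)] -/
def gaussLamMeasure (lam : ℝ) : Measure (EuclideanSpace ℝ (Fin 2)) :=
  volume.withDensity fun x =>
    ENNReal.ofReal (Real.exp (-((1 + lam) / 4 * x 0 ^ 2 + (1 - lam) / 4 * x 1 ^ 2)))

section Measure

variable (lam : ℝ)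

/-- The density `ρ_λ` is continuous. [folklore] -/
theorem continuous_expNegQuadLam : Continuous fun x : EuclideanSpace ℝ (Fin 2) =>
    Real.exp (-((1 + lam) / 4 * x 0 ^ 2 + (1 - lam) / 4 * x 1 ^ 2)) :=
  (contDiff_exp_neg_quadraticLam lam (n := 0)).continuous

/-- The `ℝ≥0∞`-valued density of `μ_λ` is measurable. [folklore] -/
theorem measurable_gaussLamDensity : Measurable fun x : EuclideanSpace ℝ (Fin 2) =>
    ENNReal.ofReal (Real.exp (-((1 + lam) / 4 * x 0 ^ 2 + (1 - lam) / 4 * x 1 ^ 2))) :=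
  (continuous_expNegQuadLam lam).measurable.ennreal_ofReal

/-- `μ_λ` is locally finite (continuous density). [folklore] -/
instance isLocallyFiniteMeasure_gaussLamMeasure : IsLocallyFiniteMeasure (gaussLamMeasure lam) :=
  IsLocallyFiniteMeasure.withDensity_ofReal (continuous_expNegQuadLam lam)

/-- `μ_λ` is a finite measure for `λ ∈ [0,1)` (total mass `∫ ρ_λ = 4π/√(1−λ²)`). [folklore] -/
theorem isFiniteMeasure_gaussLamMeasure {lam : ℝ} (hlam : lam ∈ Set.Ico (0 : ℝ) 1) :
    IsFiniteMeasure (gaussLamMeasure lam) :=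
  isFiniteMeasure_withDensity_ofReal (integrable_expNegQuadLam hlam).hasFiniteIntegral

/-- `μ_λ ≪ dx`. [folklore] -/
theorem gaussLamMeasure_absolutelyContinuous :
    gaussLamMeasure lam ≪ (volume : Measure (EuclideanSpace ℝ (Fin 2))) :=
  withDensity_absolutelyContinuous _ _

/-- `dx ≪ μ_λ` (the density is positive). [folklore] -/
theorem absolutelyContinuous_gaussLamMeasure :
    (volume : Measure (EuclideanSpace ℝ (Fin 2))) ≪ gaussLamMeasure lam :=
  withDensity_absolutelyContinuous' (measurable_gaussLamDensity lam).aemeasurable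
    (Eventually.of_forall fun _ => (ENNReal.ofReal_pos.2 (Real.exp_pos _)).ne')

/-- A.e. statements for `μ_λ` and for Lebesgue measure coincide. [folklore] -/
theorem ae_gaussLamMeasure_iff {p : EuclideanSpace ℝ (Fin 2) → Prop} :
    (∀ᵐ x ∂gaussLamMeasure lam, p x) ↔ ∀ᵐ x ∂(volume : Measure (EuclideanSpace ℝ (Fin 2))), p x :=
  ⟨fun h => (absolutelyContinuous_gaussLamMeasure lam).ae_le h,
    fun h => (gaussLamMeasure_absolutelyContinuous lam).ae_le h⟩

/-- **Integrals against `μ_λ` are weighted Lebesgue integrals**: `∫ f dμ_λ = ∫ f ρ_λ dx`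
(scalar integrands). [folklore] -/
theorem integral_gaussLamMeasure (f : EuclideanSpace ℝ (Fin 2) → ℝ) :
    ∫ x, f x ∂gaussLamMeasure lam =
      ∫ x, f x * Real.exp (-((1 + lam) / 4 * x 0 ^ 2 + (1 - lam) / 4 * x 1 ^ 2)) := by
  rw [gaussLamMeasure, integral_withDensity_eq_integral_toReal_smul (measurable_gaussLamDensity lam)
    (Eventually.of_forall fun x => ENNReal.ofReal_lt_top)]
  refine integral_congr_ae (Eventually.of_forall fun x => ?_)
  simp only [smul_eq_mul]
  rw [ENNReal.toReal_ofReal (Real.exp_pos _).le, mul_comm]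

/-- `∫ F dμ_λ = ∫ ρ_λ • F dx` for vector-valued integrands. [folklore] -/
theorem integral_gaussLamMeasure_smul {F : Type*} [NormedAddCommGroup F] [NormedSpace ℝ F]
    (f : EuclideanSpace ℝ (Fin 2) → F) :
    ∫ x, f x ∂gaussLamMeasure lam =
      ∫ x, Real.exp (-((1 + lam) / 4 * x 0 ^ 2 + (1 - lam) / 4 * x 1 ^ 2)) • f x := by
  rw [gaussLamMeasure, integral_withDensity_eq_integral_toReal_smul (measurable_gaussLamDensity lam)
    (Eventually.of_forall fun x => ENNReal.ofReal_lt_top)]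
  refine integral_congr_ae (Eventually.of_forall fun x => ?_)
  simp only
  rw [ENNReal.toReal_ofReal (Real.exp_pos _).le]

/-- Integrability against `μ_λ`. [folklore] -/
theorem integrable_gaussLamMeasure_iff {f : EuclideanSpace ℝ (Fin 2) → ℝ} :
    Integrable f (gaussLamMeasure lam) ↔
      Integrable fun x => f x * Real.exp (-((1 + lam) / 4 * x 0 ^ 2 + (1 - lam) / 4 * x 1 ^ 2)) := by
  rw [gaussLamMeasure, integrable_withDensity_iff (measurable_gaussLamDensity lam)
    (Eventually.of_forall fun x => ENNReal.ofReal_lt_top)]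
  refine integrable_congr (Eventually.of_forall fun x => ?_)
  simp only
  rw [ENNReal.toReal_ofReal (Real.exp_pos _).le]

/-- Continuous compactly supported functions lie in every `Lᵖ(μ_λ)`. [folklore] -/
theorem memLp_gaussLamMeasure_of_hasCompactSupport {F : Type*} [NormedAddCommGroup F]
    {f : EuclideanSpace ℝ (Fin 2) → F} (hf : Continuous f) (hfc : HasCompactSupport f) (p : ENNReal) :
    MemLp f p (gaussLamMeasure lam) :=
  hf.memLp_of_hasCompactSupport hfc

/-- Bounded (a.e. strongly measurable) functions lie in `L²(μ_λ)`, `λ ∈ [0,1)`. [folklore] -/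
theorem memLp_two_gaussLamMeasure_of_bound {lam : ℝ} (hlam : lam ∈ Set.Ico (0 : ℝ) 1)
    {F : Type*} [NormedAddCommGroup F] {f : EuclideanSpace ℝ (Fin 2) → F}
    (hf : AEStronglyMeasurable f volume) {C : ℝ} (hC : ∀ x, ‖f x‖ ≤ C) :
    MemLp f 2 (gaussLamMeasure lam) := by
  haveI := isFiniteMeasure_gaussLamMeasure hlam
  exact MemLp.of_bound (hf.mono_ac (gaussLamMeasure_absolutelyContinuous lam)) C
    (Eventually.of_forall hC)

end Measure

/-! ### Test functions and their graphs `(φ, ∇φ)` -/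

/-- The test functions `C_c^∞(ℝ²)` as a submodule of `ℝ² → ℝ`. [folklore] -/
def planarTestFunctions : Submodule ℝ (EuclideanSpace ℝ (Fin 2) → ℝ) where
  carrier := {φ | ContDiff ℝ ∞ φ ∧ HasCompactSupport φ}
  add_mem' := fun ha hb => ⟨ha.1.add hb.1, ha.2.add hb.2⟩
  zero_mem' := ⟨contDiff_const, by
    rw [HasCompactSupport, tsupport, Function.support_zero, closure_empty]
    exact isCompact_empty⟩
  smul_mem' := fun c φ h => ⟨h.1.const_smul c, h.2.smul_left (f := fun _ => c)⟩

/-- Membership in `planarTestFunctions`. [folklore] -/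
theorem mem_planarTestFunctions {φ : EuclideanSpace ℝ (Fin 2) → ℝ} :
    φ ∈ planarTestFunctions ↔ ContDiff ℝ ∞ φ ∧ HasCompactSupport φ := Iff.rfl

namespace planarTestFunctions

variable (φ : planarTestFunctions)

/-- A test function is smooth. [folklore] -/
theorem contDiff : ContDiff ℝ ∞ (φ : EuclideanSpace ℝ (Fin 2) → ℝ) := φ.2.1

/-- A test function has compact support. [folklore] -/
theorem hasCompactSupport : HasCompactSupport (φ : EuclideanSpace ℝ (Fin 2) → ℝ) := φ.2.2

/-- A test function is continuous. [folklore] -/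
theorem continuous : Continuous (φ : EuclideanSpace ℝ (Fin 2) → ℝ) := φ.2.1.continuous

/-- The gradient of a test function is continuous. [folklore] -/
theorem continuous_gradient : Continuous (gradient (φ : EuclideanSpace ℝ (Fin 2) → ℝ)) :=
  continuous_gradient_fin_two φ.2.1

/-- The gradient of a test function has compact support. [folklore] -/
theorem hasCompactSupport_gradient :
    HasCompactSupport (gradient (φ : EuclideanSpace ℝ (Fin 2) → ℝ)) :=
  hasCompactSupport_gradient_fin_two φ.2.2

/-- The gradient is additive on test functions. [folklore] -/
theorem gradient_add (ψ : planarTestFunctions) :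
    gradient ((φ + ψ : planarTestFunctions) : EuclideanSpace ℝ (Fin 2) → ℝ) =
      gradient (φ : EuclideanSpace ℝ (Fin 2) → ℝ) + gradient (ψ : EuclideanSpace ℝ (Fin 2) → ℝ) := by
  funext x
  have hφ := (φ.2.1.differentiable (by simp)) x
  have hψ := (ψ.2.1.differentiable (by simp)) x
  rw [Submodule.coe_add, Pi.add_apply, gradient, gradient, gradient, fderiv_add hφ hψ, map_add]

/-- The gradient is homogeneous on test functions. [folklore] -/
theorem gradient_smul (c : ℝ) :
    gradient ((c • φ : planarTestFunctions) : EuclideanSpace ℝ (Fin 2) → ℝ) =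
      c • gradient (φ : EuclideanSpace ℝ (Fin 2) → ℝ) := by
  funext x
  have hφ := (φ.2.1.differentiable (by simp)) x
  rw [Submodule.coe_smul, Pi.smul_apply, gradient, gradient, fderiv_const_smul hφ, map_smul]

end planarTestFunctions

section Graph

variable (lam : ℝ)

/-- A test function as an element of `L²(μ_λ)`. [folklore] -/
theorem memLp_planarTestFunction (φ : planarTestFunctions) :
    MemLp (φ : EuclideanSpace ℝ (Fin 2) → ℝ) 2 (gaussLamMeasure lam) :=
  memLp_gaussLamMeasure_of_hasCompactSupport lam (planarTestFunctions.continuous φ)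
    (planarTestFunctions.hasCompactSupport φ) 2

/-- The gradient of a test function as an element of `L²(μ_λ; ℝ²)`. [folklore] -/
theorem memLp_gradient_planarTestFunction (φ : planarTestFunctions) :
    MemLp (gradient (φ : EuclideanSpace ℝ (Fin 2) → ℝ)) 2 (gaussLamMeasure lam) :=
  memLp_gaussLamMeasure_of_hasCompactSupport lam (planarTestFunctions.continuous_gradient φ)
    (planarTestFunctions.hasCompactSupport_gradient φ) 2

/-- **The graph map `φ ↦ (φ, ∇φ)`** from `C_c^∞(ℝ²)` into the Hilbert space
`L²(μ_λ) × L²(μ_λ; ℝ²)` (`ℓ²`-product norm). [folklore] -/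
def gaussLamGraph : planarTestFunctions →ₗ[ℝ]
    WithLp 2 (Lp ℝ 2 (gaussLamMeasure lam) × Lp (EuclideanSpace ℝ (Fin 2)) 2 (gaussLamMeasure lam)) where
  toFun φ := toLp 2 ((memLp_planarTestFunction lam φ).toLp _,
    (memLp_gradient_planarTestFunction lam φ).toLp _)
  map_add' φ ψ := by
    have h1 : (memLp_planarTestFunction lam (φ + ψ)).toLp _ =
        (memLp_planarTestFunction lam φ).toLp _ + (memLp_planarTestFunction lam ψ).toLp _ := by
      rw [← MemLp.toLp_add]; rfl
    have h2 : (memLp_gradient_planarTestFunction lam (φ + ψ)).toLp _ =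
        (memLp_gradient_planarTestFunction lam φ).toLp _ +
          (memLp_gradient_planarTestFunction lam ψ).toLp _ := by
      rw [← MemLp.toLp_add]
      exact (MemLp.toLp_eq_toLp_iff _ _).2 (Eventually.of_forall fun x => by
        simp only [planarTestFunctions.gradient_add, Pi.add_apply])
    rw [h1, h2, ← WithLp.toLp_add, Prod.mk_add_mk]
  map_smul' c φ := by
    have h1 : (memLp_planarTestFunction lam (c • φ)).toLp _ =
        c • (memLp_planarTestFunction lam φ).toLp _ := by
      rw [← MemLp.toLp_const_smul]; rfl
    have h2 : (memLp_gradient_planarTestFunction lam (c • φ)).toLp _ =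
        c • (memLp_gradient_planarTestFunction lam φ).toLp _ := by
      rw [← MemLp.toLp_const_smul]
      exact (MemLp.toLp_eq_toLp_iff _ _).2 (Eventually.of_forall fun x => by
        simp only [planarTestFunctions.gradient_smul, Pi.smul_apply])
    rw [RingHom.id_apply, h1, h2, ← WithLp.toLp_smul, Prod.smul_mk]

/-- First component of the graph: the test function itself in `L²(μ_λ)`. [folklore] -/
theorem gaussLamGraph_fst (φ : planarTestFunctions) :
    (gaussLamGraph lam φ).fst = (memLp_planarTestFunction lam φ).toLp _ := rfl

/-- Second component of the graph: the gradient in `L²(μ_λ; ℝ²)`. [folklore] -/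
theorem gaussLamGraph_snd (φ : planarTestFunctions) :
    (gaussLamGraph lam φ).snd = (memLp_gradient_planarTestFunction lam φ).toLp _ := rfl

/-! ### The form domain `H¹(μ_λ)` -/

/-- **The form domain `H¹(μ_λ)` of `L_λ`** (weighted Sobolev space; Gallay–Maekawa 2016, (4.6),
`W^{1,2}(∞;λ)` in the vorticity picture): the closure in `L²(μ_λ) × L²(μ_λ; ℝ²)` of the graphs
`(φ, ∇φ)` of test functions. A closed subspace of a Hilbert space, hence a Hilbert space; the
second component of `U ∈ H¹(μ_λ)` is the weak gradient of the first. [cite: GallayMaekawa2016, (4.6)] -/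
def gaussLamFormDomain : Submodule ℝ
    (WithLp 2 (Lp ℝ 2 (gaussLamMeasure lam) × Lp (EuclideanSpace ℝ (Fin 2)) 2 (gaussLamMeasure lam))) :=
  (LinearMap.range (gaussLamGraph lam)).topologicalClosure

/-- `H¹(μ_λ)` is closed. [folklore] -/
theorem isClosed_gaussLamFormDomain :
    IsClosed (gaussLamFormDomain lam :
      Set (WithLp 2 (Lp ℝ 2 (gaussLamMeasure lam) ×
        Lp (EuclideanSpace ℝ (Fin 2)) 2 (gaussLamMeasure lam)))) :=
  Submodule.isClosed_topologicalClosure _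

/-- `H¹(μ_λ)` is a Hilbert space. [folklore] -/
instance completeSpace_gaussLamFormDomain : CompleteSpace (gaussLamFormDomain lam) :=
  (isClosed_gaussLamFormDomain lam).completeSpace_coe

/-- Graphs of test functions belong to `H¹(μ_λ)`. [folklore] -/
theorem gaussLamGraph_mem (φ : planarTestFunctions) : gaussLamGraph lam φ ∈ gaussLamFormDomain lam :=
  Submodule.le_topologicalClosure _ (LinearMap.mem_range_self _ φ)

/-- **Closure principle for `H¹(μ_λ)`**: a property which defines a closed set and holds on all
graphs of test functions holds on `H¹(μ_λ)`. [folklore] -/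
theorem gaussLamFormDomain_induction
    {P : WithLp 2 (Lp ℝ 2 (gaussLamMeasure lam) ×
      Lp (EuclideanSpace ℝ (Fin 2)) 2 (gaussLamMeasure lam)) → Prop}
    (hP : IsClosed {U | P U}) (hgraph : ∀ φ : planarTestFunctions, P (gaussLamGraph lam φ))
    {U : WithLp 2 (Lp ℝ 2 (gaussLamMeasure lam) ×
      Lp (EuclideanSpace ℝ (Fin 2)) 2 (gaussLamMeasure lam))}
    (hU : U ∈ gaussLamFormDomain lam) : P U := by
  have h : (gaussLamFormDomain lam : Set _) ⊆ {U | P U} := by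
    rw [gaussLamFormDomain, Submodule.topologicalClosure_coe]
    refine closure_minimal ?_ hP
    rintro _ ⟨φ, rfl⟩
    exact hgraph φ
  exact h hU

end Graph

end Literature.Analysis.FluidPDE
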